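import Literature.MathematicalPhysics.QuantumFieldTheory.Balaban1983to89.B12Ext436Lattice
import Literature.MathematicalPhysics.QuantumFieldTheory.Balaban1983to89.TreeLengthTorus
import Summits.QuantumFields.BalabanUV.T4Continuum.Spine.NE7.QLaCensusDecay

/-!
# Spine/NE7/QLaCensusTreeDecay — file 38's format caveat discharged BY NAME: the PRINTED tree decay `E₀·exp(−κ·d_j(X))` of
# [Balaban1987RG1] (0.25) IS geometric decay in the cube count (the tree's `TreeLength.card_le_treeLen` ∕ `card_le_torusTreeLen`),
# localization domains ARE `R`-connected cell sets for the wall adjacency (the tree's `B12Ext436Lattice` ∕ `TreeLengthTorus`), and the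
# per-cube ledger census of NODE S follows in the printed format — through file 38's animal bound, or directly from the tree's (1.26)

Cell `pub-balaban-gaps` (YM blitz Y1, track G2, seat `ne7`, generation 11); text of record
`run/shared/lean/pub/pub-balaban-gaps/ne/NE7.md` (v11: census R69).  42nd `Spine/NE7/` file; 0 `def`, 0 sorry.

WHY.  File 38 (`QLaCensusDecay`) derived NODE S's per-cube ledger census (file 36's hypothesis `hcell`, the (0.26)-type bound) from two
FORMAT facts — (F-conn) domains are `R`-connected cell sets, (F-decay) weights `≤ C·λ^{#cells}` with `(Δ+1)²λ ≤ ½` — and left ONE comparison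
to print in its docstring: *"In print `λ = e^{−κ}` up to the comparison `d_k(X) ≳ #cubes of X` for connected unions of cubes"*.  Everything
that comparison needs is ALREADY IN THE TREE, and this file only wires it to the ledger format of files 36∕38: (a) the cell's model of the
linear size, `TreeLength.treeLen` on the cover `ℤ^d` and `TreeLengthTorus.torusTreeLen` on the papers' periodic carrier ([Balaban1987RG1]
p. 257 *"A length of a shortest graph in this class, divided by M, is the linear size of X"*), with the volume bounds `card_le_treeLen` ∕
`card_le_torusTreeLen` (`|Y| ≤ 2^d(4·d(Y)+1)`, the repaired lower half of [Balaban1988RG2Cluster] (2.30) after [Dimock2013BalabanII] App. E);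
(b) localization domains as `IsRConnected` cell sets for the wall adjacency with `2d` neighbours: `B12Ext436Lattice.isRConnected_of_faceConnected`
∕ `nbrZ` ∕ `mem_nbrZ` ∕ `card_nbrZ_le` on `ℤ^d`, `TreeLengthTorus.isRConnected_of_tFaceConnected` ∕ `tnbr` ∕ `mem_tnbr` ∕ `tdegreeLE` on the torus;
(c) the printed per-cube family bound (1.26) itself, `B12Ext436Lattice.sum_exp_treeLen_le` (`Σ_{X ∋ □} e^{−κ·d(X)} ≤ K₀(4·2^d, 2d)` for
`κ ≥ κ₀(4·2^d, 2d)`).  HERE: §1 `exp(−κ·d(Y)) ≤ e^{κ/4}·(e^{−κ/2^{d+2}})^{|Y|}` (`exp_treeDecay_le_pow_card`, `torusTreeDecay_le_pow_card`: print's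
format IS (F-decay) with `C = E₀e^{κ/4}`, `λ = e^{−κ/2^{d+2}}`) and the animal smallness `(2d+1)²λ ≤ ½` from `κ ≥ κ₀(4·2^d, 2d) = 4·2^d·log(2(2d+1)²)`
(`adj_smallness_of_le`, `adj_smallness_of_kappa₀_le` — (0.25)'s *"sufficiently large constant κ"* is the tree's printed-constant rate
`B12TreeDecay.kappa₀`, `64·log 162` at d = 4); §2 file 38's per-cube census in the PRINTED format on `ℤ^d` and on the torus
(`perCell_census_of_treeDecay`, `perCell_census_of_torusTreeDecay`: a ledger of pairwise-distinct localization domains per scale with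
`w_i ≤ E₀·exp(−κ·d(Y_i))` has `Σ_{sc i = j, x ∈ Y_i} w_i ≤ E₀e^{κ/4}·2e^{−κ/2^{d+2}}`); §3 the same census DIRECTLY from the tree's (1.26) on `ℤ^d` and on the torus, constant
`E₀·K₀(4·2^d, 2d)` (`perCell_census_of_treeDecay_K₀`, `perCell_census_of_torusTreeDecay_K₀` over `TreeLengthTorus.ineq126_torus`); §4 the bond-cell twin of file 38's torus multiplicity (`multiplicity_of_connected_decay_bonds`,
count = file 36's `card_pbond_eq_unit_mul_real`).  What is NOT here: WHICH cube families a Bałaban ledger's domains are, and the ledger INSTANCE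
on the (2.18) [III] objects — NODE O's format (α)∕(γ), unchanged.

HONEST FRAMING.  Real arithmetic and finite sums over TREE theorems cited by name; the decay format is a HYPOTHESIS named after (0.25)∕(1.100),
NOT an assertion about Bałaban's terms (no object of (2.18) [III] exists in the tree: NODE O).  NE7 NOT proved; spine 0∕9; one fixed finite
T⁴ — NOT ℝ⁴, NOT infinite volume, NOT a mass gap, NOT Clay.  No classification word moves (R10).
-/

noncomputable section

open Finset
open scoped BigOperators

namespace Summit.QuantumFields.BalabanUV.T4Continuum.Spine.NE7

open Literature.MathematicalPhysics.QuantumFieldTheory.Balaban1983to89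
open Literature.MathematicalPhysics.QuantumFieldTheory.Balaban1983to89.B13ScaleTransfer (Pt Adj FaceConnected)
open Literature.MathematicalPhysics.QuantumFieldTheory.Balaban1983to89.TreeLength (treeLen card_le_treeLen)
open Literature.MathematicalPhysics.QuantumFieldTheory.Balaban1983to89.TreeLengthTorus (TPt TAdj TFaceConnected IsTDom TDom tsys
  tcubeSys tcubeSys_cubes tsys_dj torusTreeLen card_le_torusTreeLen tnbr mem_tnbr tdegreeLE isRConnected_of_tFaceConnected ineq126_torus)
open Literature.MathematicalPhysics.QuantumFieldTheory.Balaban1983to89.B12Ext436Lattice (nbrZ mem_nbrZ card_nbrZ_le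
  isRConnected_of_faceConnected sum_exp_treeLen_le)
open Literature.MathematicalPhysics.QuantumFieldTheory.Balaban1983to89.B12TreeDecay (kappa₀ a₀ K₀ kappa₀_nonneg K₀_pos)
open Literature.MathematicalPhysics.QuantumFieldTheory.Balaban1983to89.B12TreeDecay.CubeSystem (mem_above)
open Literature.MathematicalPhysics.QuantumFieldTheory.Balaban1983to89.T4RecentScale (Multiplicity)
open Literature.Probability.LatticeModels (IsRConnected)

variable {d : ℕ}

/-! ## §1 The printed tree decay is geometric decay in the cube count; the animal smallness from `κ ≥ κ₀(4·2^d, 2d)` -/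

/-- `d(Y) ≥ (|Y|/2^d − 1)/4` for every localization domain of `ℤ^d` — the tree's `TreeLength.card_le_treeLen` solved for `d(Y)`. [folklore] -/
theorem card_div_le_treeLen {Y : Finset (Pt d)} (hY : Y.Nonempty) (hc : FaceConnected Y) :
    ((Y.card : ℝ) / 2 ^ d - 1) / 4 ≤ treeLen Y := by
  have h := card_le_treeLen hY hc
  have h2d : (0 : ℝ) < 2 ^ d := by positivity
  rw [div_le_iff₀ (by norm_num : (0 : ℝ) < 4), sub_le_iff_le_add, div_le_iff₀ h2d]
  linarith

/-- kernel: `exp(−κ·t) ≤ e^{κ/4}·(e^{−κ/(4·2^d)})^{n}` whenever `(n/2^d − 1)/4 ≤ t` and `κ ≥ 0`. [folklore] -/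
private theorem exp_le_pow_of_card_div_le {t κ : ℝ} {n : ℕ} (h : ((n : ℝ) / 2 ^ d - 1) / 4 ≤ t) (hκ : 0 ≤ κ) :
    Real.exp (-κ * t) ≤ Real.exp (κ / 4) * Real.exp (-(κ / (4 * 2 ^ d))) ^ n := by
  have h2d : (0 : ℝ) < 2 ^ d := by positivity
  rw [← Real.exp_nat_mul, ← Real.exp_add]
  refine Real.exp_le_exp.mpr ?_
  have h1 : -κ * t ≤ -κ * (((n : ℝ) / 2 ^ d - 1) / 4) := by nlinarith
  have h2 : -κ * (((n : ℝ) / 2 ^ d - 1) / 4) = κ / 4 + (n : ℝ) * -(κ / (4 * 2 ^ d)) := by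
    field_simp
    ring
  linarith

/-- **TREE DECAY IS GEOMETRIC DECAY IN THE CUBE COUNT** (`ℤ^d`): for a localization domain `Y` and `κ ≥ 0`,
`exp(−κ·d(Y)) ≤ e^{κ/4}·(e^{−κ/(4·2^d)})^{|Y|}`. [folklore] -/
theorem exp_treeDecay_le_pow_card {Y : Finset (Pt d)} (hY : Y.Nonempty) (hc : FaceConnected Y) {κ : ℝ} (hκ : 0 ≤ κ) :
    Real.exp (-κ * treeLen Y) ≤ Real.exp (κ / 4) * Real.exp (-(κ / (4 * 2 ^ d))) ^ Y.card :=
  exp_le_pow_of_card_div_le (card_div_le_treeLen hY hc) hκ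

/-- With a prefactor: `E₀·exp(−κ·d(Y)) ≤ (E₀·e^{κ/4})·(e^{−κ/(4·2^d)})^{|Y|}` (`E₀ ≥ 0`) — print's (0.25) format IS file 38's (F-decay) with
`C = E₀e^{κ/4}`, `λ = e^{−κ/2^{d+2}}`. [folklore] -/
theorem treeDecay_le_pow_card {Y : Finset (Pt d)} (hY : Y.Nonempty) (hc : FaceConnected Y) {E₀ κ w : ℝ} (hE : 0 ≤ E₀)
    (hκ : 0 ≤ κ) (hw : w ≤ E₀ * Real.exp (-κ * treeLen Y)) :
    w ≤ E₀ * Real.exp (κ / 4) * Real.exp (-(κ / (4 * 2 ^ d))) ^ Y.card := by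
  rw [mul_assoc]
  exact hw.trans (mul_le_mul_of_nonneg_left (exp_treeDecay_le_pow_card hY hc hκ) hE)

section Torus

variable {N : ℕ} [NeZero N]

/-- On the torus: `d_j(Ȳ) ≥ (|Ȳ|/2^d − 1)/4` — the tree's `TreeLengthTorus.card_le_torusTreeLen` solved for the linear size. [folklore] -/
theorem card_div_le_torusTreeLen {Y : Finset (TPt d N)} (hY : Y.Nonempty) (hc : TFaceConnected Y) :
    ((Y.card : ℝ) / 2 ^ d - 1) / 4 ≤ torusTreeLen Y := by
  have h := card_le_torusTreeLen hY hc
  have h2d : (0 : ℝ) < 2 ^ d := by positivity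
  rw [div_le_iff₀ (by norm_num : (0 : ℝ) < 4), sub_le_iff_le_add, div_le_iff₀ h2d]
  linarith

/-- On the torus: `E₀·exp(−κ·d_j(Ȳ)) ≤ (E₀·e^{κ/4})·(e^{−κ/(4·2^d)})^{|Ȳ|}` for every torus localization domain. [folklore] -/
theorem torusTreeDecay_le_pow_card {Y : Finset (TPt d N)} (hY : Y.Nonempty) (hc : TFaceConnected Y) {E₀ κ w : ℝ}
    (hE : 0 ≤ E₀) (hκ : 0 ≤ κ) (hw : w ≤ E₀ * Real.exp (-κ * torusTreeLen Y)) :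
    w ≤ E₀ * Real.exp (κ / 4) * Real.exp (-(κ / (4 * 2 ^ d))) ^ Y.card := by
  rw [mul_assoc]
  exact hw.trans (mul_le_mul_of_nonneg_left (exp_le_pow_of_card_div_le (card_div_le_torusTreeLen hY hc) hκ) hE)

end Torus

/-- **"WITH A SUFFICIENTLY LARGE CONSTANT κ"** ((0.25) p. 257), explicitly: if `κ ≥ 4·2^d·log(2(2d+1)²)` then the lattice-animal
smallness `(2d+1)²·e^{−κ/(4·2^d)} ≤ ½` of file 38 holds for the wall adjacency (`Δ = 2d`). [folklore] -/
theorem adj_smallness_of_le {κ : ℝ} (hκ : 4 * 2 ^ d * Real.log (2 * (((2 * d : ℕ) : ℝ) + 1) ^ 2) ≤ κ) :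
    (((2 * d : ℕ) : ℝ) + 1) ^ 2 * Real.exp (-(κ / (4 * 2 ^ d))) ≤ 1 / 2 := by
  set A : ℝ := (((2 * d : ℕ) : ℝ) + 1) ^ 2 with hA
  have hApos : 0 < A := by positivity
  have hc : (0 : ℝ) < 4 * 2 ^ d := by positivity
  have hlog : Real.log (2 * A) ≤ κ / (4 * 2 ^ d) := by
    rw [le_div_iff₀ hc]; linarith
  have hexp : Real.exp (-(κ / (4 * 2 ^ d))) ≤ (2 * A)⁻¹ := by
    rw [← Real.exp_log (by positivity : 0 < 2 * A), ← Real.exp_neg]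
    exact Real.exp_le_exp.mpr (by linarith)
  calc A * Real.exp (-(κ / (4 * 2 ^ d))) ≤ A * (2 * A)⁻¹ := mul_le_mul_of_nonneg_left hexp hApos.le
    _ = 1 / 2 := by field_simp

/-- The threshold IS the tree's printed-constant rate `B12TreeDecay.kappa₀ (4·2^d) (2d) = 4·2^d·log(2(2d+1)²)` ([Dimock2013BalabanII] App. A
Lemma 25; the rate at which the tree's (1.26) runs on `ℤ^d` (`B12Ext436Lattice.ineq126_latt`) and on the torus
(`TreeLengthTorus.ineq126_torus`); `64·log 162` at d = 4, `TreeLengthTorusGeometry.tgeometry_consts_four`). [folklore] -/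
theorem adj_smallness_of_kappa₀_le {κ : ℝ} (hκ : kappa₀ (4 * 2 ^ d) (2 * d) ≤ κ) :
    (((2 * d : ℕ) : ℝ) + 1) ^ 2 * Real.exp (-(κ / (4 * 2 ^ d))) ≤ 1 / 2 := by
  refine adj_smallness_of_le ?_
  simpa only [kappa₀, a₀] using hκ

/-! ## §2 File 38's per-cube census in the printed format (animal route), on `ℤ^d` and on the torus -/

/-- **THE PER-CUBE CENSUS FROM THE PRINTED DECAY FORMAT** (`ℤ^d`).  A ledger `fac` with scales `sc` and scale-wise cube families
`cells j i ⊆ ℤ^d` such that (F-dom) every entry's family is a localization domain (non-empty, face-connected) and `cells j` is injective on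
the scale-`j` slice, and (F-0.25) `w i ≤ E₀·exp(−κ·d(cells i))` with `E₀, κ ≥ 0` and the smallness `(2d+1)²·e^{−κ/(4·2^d)} ≤ ½`.  Then for
every scale `j` and cube `x`: `Σ_{sc i = j, x ∈ cells j i} w i ≤ E₀·e^{κ/4}·(2·e^{−κ/(4·2^d)})` — file 38's `perCell_census_of_connected_decay`
with `R = Adj`, the tree's neighbour lists `nbrZ` (`card_nbrZ_le`: `Δ = 2d`), `λ = e^{−κ/(4·2^d)}`, `C = E₀·e^{κ/4}`, (F-conn) by the tree's
`isRConnected_of_faceConnected`, (F-decay) by §1. [folklore] -/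
theorem perCell_census_of_treeDecay {ι : Type*} (fac : Finset ι) (sc : ι → ℕ) (cells : ℕ → ι → Finset (Pt d))
    (w : ι → ℝ) {E₀ κ : ℝ} (hE : 0 ≤ E₀) (hκ : 0 ≤ κ)
    (hsmall : (((2 * d : ℕ) : ℝ) + 1) ^ 2 * Real.exp (-(κ / (4 * 2 ^ d))) ≤ 1 / 2)
    (hdom : ∀ i ∈ fac, (cells (sc i) i).Nonempty ∧ FaceConnected (cells (sc i) i))
    (hinj : ∀ j, Set.InjOn (cells j) ↑(fac.filter fun i => sc i = j))
    (hw : ∀ i ∈ fac, w i ≤ E₀ * Real.exp (-κ * treeLen (cells (sc i) i))) (j : ℕ) (x : Pt d) :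
    ∑ i ∈ (fac.filter fun i => sc i = j) with x ∈ cells j i, w i
      ≤ E₀ * Real.exp (κ / 4) * (2 * Real.exp (-(κ / (4 * 2 ^ d)))) := by
  have hC : 0 ≤ E₀ * Real.exp (κ / 4) := mul_nonneg hE (Real.exp_pos _).le
  have hlam : 0 ≤ Real.exp (-(κ / (4 * 2 ^ d))) := (Real.exp_pos _).le
  have hconn : ∀ i ∈ fac, IsRConnected Adj (cells (sc i) i) := fun i hi =>
    isRConnected_of_faceConnected (hdom i hi).1 (hdom i hi).2
  have hw' : ∀ i ∈ fac, w i ≤ E₀ * Real.exp (κ / 4) * Real.exp (-(κ / (4 * 2 ^ d))) ^ (cells (sc i) i).card :=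
    fun i hi => treeDecay_le_pow_card (hdom i hi).1 (hdom i hi).2 hE hκ (hw i hi)
  have hΔ : ∀ y : Pt d, (nbrZ y).card ≤ 2 * d := fun y => card_nbrZ_le y
  exact perCell_census_of_connected_decay (S := fun _ : ℕ => Pt d) (Δ := 2 * d) (C := E₀ * Real.exp (κ / 4))
    (lam := Real.exp (-(κ / (4 * 2 ^ d)))) fac sc cells w (fun _ : ℕ => (Adj : Pt d → Pt d → Prop))
    (fun (_ : ℕ) (y : Pt d) => nbrZ y) (fun _ _ _ h => h.symm) (fun _ y => hΔ y)
    (fun _ _ _ h => mem_nbrZ h) hC hlam hsmall hconn hinj hw' j x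

section Torus

variable {N : ℕ} [NeZero N]

/-- **THE SAME ON THE PAPERS' PERIODIC CARRIER**: torus cube families (`TPt d N = Fin d → ZMod N`, the shape of `Setup.Site`), torus
localization domains (`TFaceConnected`), the torus wall adjacency `TAdj` with the tree's neighbour lists `tnbr` (`tdegreeLE`: `≤ 2d`;
`isRConnected_of_tFaceConnected`) and the torus linear size `torusTreeLen`: `Σ_{sc i = j, x̄ ∈ Ȳ_i} w_i ≤ E₀·e^{κ/4}·(2·e^{−κ/(4·2^d)})`. [folklore] -/
theorem perCell_census_of_torusTreeDecay {ι : Type*} (fac : Finset ι) (sc : ι → ℕ) (cells : ℕ → ι → Finset (TPt d N))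
    (w : ι → ℝ) {E₀ κ : ℝ} (hE : 0 ≤ E₀) (hκ : 0 ≤ κ)
    (hsmall : (((2 * d : ℕ) : ℝ) + 1) ^ 2 * Real.exp (-(κ / (4 * 2 ^ d))) ≤ 1 / 2)
    (hdom : ∀ i ∈ fac, (cells (sc i) i).Nonempty ∧ TFaceConnected (cells (sc i) i))
    (hinj : ∀ j, Set.InjOn (cells j) ↑(fac.filter fun i => sc i = j))
    (hw : ∀ i ∈ fac, w i ≤ E₀ * Real.exp (-κ * torusTreeLen (cells (sc i) i))) (j : ℕ) (x : TPt d N) :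
    ∑ i ∈ (fac.filter fun i => sc i = j) with x ∈ cells j i, w i
      ≤ E₀ * Real.exp (κ / 4) * (2 * Real.exp (-(κ / (4 * 2 ^ d)))) := by
  have hC : 0 ≤ E₀ * Real.exp (κ / 4) := mul_nonneg hE (Real.exp_pos _).le
  have hlam : 0 ≤ Real.exp (-(κ / (4 * 2 ^ d))) := (Real.exp_pos _).le
  have hconn : ∀ i ∈ fac, IsRConnected TAdj (cells (sc i) i) := fun i hi =>
    isRConnected_of_tFaceConnected (hdom i hi).1 (hdom i hi).2
  have hw' : ∀ i ∈ fac, w i ≤ E₀ * Real.exp (κ / 4) * Real.exp (-(κ / (4 * 2 ^ d))) ^ (cells (sc i) i).card :=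
    fun i hi => torusTreeDecay_le_pow_card (hdom i hi).1 (hdom i hi).2 hE hκ (hw i hi)
  have hΔ : ∀ y : TPt d N, (tnbr y).card ≤ 2 * d := fun y => tdegreeLE d N y
  exact perCell_census_of_connected_decay (S := fun _ : ℕ => TPt d N) (Δ := 2 * d) (C := E₀ * Real.exp (κ / 4))
    (lam := Real.exp (-(κ / (4 * 2 ^ d)))) fac sc cells w (fun _ : ℕ => (TAdj : TPt d N → TPt d N → Prop))
    (fun (_ : ℕ) (y : TPt d N) => tnbr y) (fun _ _ _ h => h.symm) (fun _ y => hΔ y)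
    (fun _ _ _ h => mem_tnbr.2 h) hC hlam hsmall hconn hinj hw' j x

end Torus

/-- The `ℤ^d` census with the threshold in the tree's form `κ ≥ κ₀(4·2^d, 2d)` in place of the smallness hypothesis (`κ ≥ 0` follows from
`kappa₀_nonneg`). [folklore] -/
theorem perCell_census_of_treeDecay_of_le {ι : Type*} (fac : Finset ι) (sc : ι → ℕ) (cells : ℕ → ι → Finset (Pt d))
    (w : ι → ℝ) {E₀ κ : ℝ} (hE : 0 ≤ E₀) (hκ : kappa₀ (4 * 2 ^ d) (2 * d) ≤ κ)
    (hdom : ∀ i ∈ fac, (cells (sc i) i).Nonempty ∧ FaceConnected (cells (sc i) i))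
    (hinj : ∀ j, Set.InjOn (cells j) ↑(fac.filter fun i => sc i = j))
    (hw : ∀ i ∈ fac, w i ≤ E₀ * Real.exp (-κ * treeLen (cells (sc i) i))) (j : ℕ) (x : Pt d) :
    ∑ i ∈ (fac.filter fun i => sc i = j) with x ∈ cells j i, w i
      ≤ E₀ * Real.exp (κ / 4) * (2 * Real.exp (-(κ / (4 * 2 ^ d)))) :=
  perCell_census_of_treeDecay fac sc cells w hE ((kappa₀_nonneg (by positivity) _).trans hκ) (adj_smallness_of_kappa₀_le hκ)
    hdom hinj hw j x

/-! ## §3 The same census DIRECTLY from the tree's (1.26) (`B12Ext436Lattice.sum_exp_treeLen_le`), constant `E₀·K₀(4·2^d, 2d)` -/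

/-- **THE PER-CUBE CENSUS FROM THE TREE's (1.26)** (`ℤ^d`): under (F-dom), injectivity on the slice and (F-0.25) with `κ ≥ κ₀(4·2^d, 2d)`,
`Σ_{sc i = j, x ∈ cells j i} w i ≤ E₀·K₀(4·2^d, 2d)` — the slice's domains through `x` are a finite family of distinct localization domains
containing `x`, to which `sum_exp_treeLen_le` ([Balaban1988RG2Cluster] (1.26) on `ℤ^d`, PROVED in the tree) applies. [folklore] -/
theorem perCell_census_of_treeDecay_K₀ {ι : Type*} (fac : Finset ι) (sc : ι → ℕ) (cells : ℕ → ι → Finset (Pt d))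
    (w : ι → ℝ) {E₀ κ : ℝ} (hE : 0 ≤ E₀) (hκ : kappa₀ (4 * 2 ^ d) (2 * d) ≤ κ)
    (hdom : ∀ i ∈ fac, (cells (sc i) i).Nonempty ∧ FaceConnected (cells (sc i) i))
    (hinj : ∀ j, Set.InjOn (cells j) ↑(fac.filter fun i => sc i = j))
    (hw : ∀ i ∈ fac, w i ≤ E₀ * Real.exp (-κ * treeLen (cells (sc i) i))) (j : ℕ) (x : Pt d) :
    ∑ i ∈ (fac.filter fun i => sc i = j) with x ∈ cells j i, w i ≤ E₀ * K₀ (4 * 2 ^ d) (2 * d) := by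
  classical
  set sl : Finset ι := (fac.filter fun i => sc i = j).filter fun i => x ∈ cells j i with hsl
  have hsl_sub : (sl : Set ι) ⊆ ↑(fac.filter fun i => sc i = j) := fun i hi => (mem_filter.mp hi).1
  have hmem : ∀ i ∈ sl, i ∈ fac ∧ sc i = j ∧ x ∈ cells j i := fun i hi => by
    obtain ⟨hi', hx⟩ := mem_filter.mp hi
    obtain ⟨hif, hij⟩ := mem_filter.mp hi'
    exact ⟨hif, hij, hx⟩
  -- each weight against the printed decay at scale j
  have h1 : ∑ i ∈ sl, w i ≤ ∑ i ∈ sl, E₀ * Real.exp (-κ * treeLen (cells j i)) := sum_le_sum fun i hi => by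
    obtain ⟨hif, hij, _⟩ := hmem i hi
    subst hij
    exact hw i hif
  -- pass to the family of domains (injective on the slice)
  have hinj' : Set.InjOn (cells j) ↑sl := (hinj j).mono hsl_sub
  have h2 : ∑ i ∈ sl, Real.exp (-κ * treeLen (cells j i)) = ∑ Y ∈ sl.image (cells j), Real.exp (-κ * treeLen Y) :=
    (sum_image (f := fun Y : Finset (Pt d) => Real.exp (-κ * treeLen Y)) fun a ha b hb h => hinj' ha hb h).symm
  have hF : ∀ Y ∈ sl.image (cells j), x ∈ Y ∧ Y.Nonempty ∧ FaceConnected Y := by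
    intro Y hY
    obtain ⟨i, hi, rfl⟩ := mem_image.mp hY
    obtain ⟨hif, hij, hx⟩ := hmem i hi
    subst hij
    exact ⟨hx, hdom i hif⟩
  have h3 := sum_exp_treeLen_le hκ x (sl.image (cells j)) hF
  calc ∑ i ∈ sl, w i ≤ ∑ i ∈ sl, E₀ * Real.exp (-κ * treeLen (cells j i)) := h1
    _ = E₀ * ∑ Y ∈ sl.image (cells j), Real.exp (-κ * treeLen Y) := by rw [← mul_sum, h2]
    _ ≤ E₀ * K₀ (4 * 2 ^ d) (2 * d) := mul_le_mul_of_nonneg_left h3 hE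

section TorusK

variable {N : ℕ} [NeZero N]

/-- **THE SAME FROM THE TREE's (1.26) ON THE TORUS** (`TreeLengthTorus.ineq126_torus`): `Σ_{sc i = j, x̄ ∈ Ȳ_i} w_i ≤ E₀·K₀(4·2^d, 2d)`
for `κ ≥ κ₀(4·2^d, 2d)` — the slice's torus localization domains through `x̄` are distinct members of the torus system's `above x̄`,
over which (1.26) bounds the full sum. [folklore] -/
theorem perCell_census_of_torusTreeDecay_K₀ {ι : Type*} (fac : Finset ι) (sc : ι → ℕ) (cells : ℕ → ι → Finset (TPt d N))
    (w : ι → ℝ) {E₀ κ : ℝ} (hE : 0 ≤ E₀) (hκ : kappa₀ (4 * 2 ^ d) (2 * d) ≤ κ)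
    (hdom : ∀ i ∈ fac, (cells (sc i) i).Nonempty ∧ TFaceConnected (cells (sc i) i))
    (hinj : ∀ j, Set.InjOn (cells j) ↑(fac.filter fun i => sc i = j))
    (hw : ∀ i ∈ fac, w i ≤ E₀ * Real.exp (-κ * torusTreeLen (cells (sc i) i))) (j : ℕ) (x : TPt d N) :
    ∑ i ∈ (fac.filter fun i => sc i = j) with x ∈ cells j i, w i ≤ E₀ * K₀ (4 * 2 ^ d) (2 * d) := by
  classical
  set sl : Finset ι := (fac.filter fun i => sc i = j).filter fun i => x ∈ cells j i with hsl
  have hsl_sub : (sl : Set ι) ⊆ ↑(fac.filter fun i => sc i = j) := fun i hi => (mem_filter.mp hi).1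
  have hmem : ∀ i ∈ sl, i ∈ fac ∧ sc i = j ∧ x ∈ cells j i := fun i hi => by
    obtain ⟨hi', hx⟩ := mem_filter.mp hi
    obtain ⟨hif, hij⟩ := mem_filter.mp hi'
    exact ⟨hif, hij, hx⟩
  have h1 : ∑ i ∈ sl, w i ≤ ∑ i ∈ sl, E₀ * Real.exp (-κ * torusTreeLen (cells j i)) := sum_le_sum fun i hi => by
    obtain ⟨hif, hij, _⟩ := hmem i hi
    subst hij
    exact hw i hif
  have hinj' : Set.InjOn (cells j) ↑sl := (hinj j).mono hsl_sub
  set Fam : Finset (Finset (TPt d N)) := sl.image (cells j) with hFam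
  have h2 : ∑ i ∈ sl, Real.exp (-κ * torusTreeLen (cells j i)) = ∑ Y ∈ Fam, Real.exp (-κ * torusTreeLen Y) :=
    (sum_image (f := fun Y : Finset (TPt d N) => Real.exp (-κ * torusTreeLen Y)) fun a ha b hb h => hinj' ha hb h).symm
  have hF : ∀ Y ∈ Fam, x ∈ Y ∧ IsTDom Y := by
    intro Y hY
    obtain ⟨i, hi, rfl⟩ := mem_image.mp hY
    obtain ⟨hif, hij, hx⟩ := hmem i hi
    subst hij
    exact ⟨hx, hdom i hif⟩
  -- pass to the torus system's domains through `x`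
  have h3 : ∑ Y ∈ Fam, Real.exp (-κ * torusTreeLen Y)
      = ∑ X ∈ Fam.subtype IsTDom, Real.exp (-κ * torusTreeLen X.1) :=
    (Finset.sum_subtype_of_mem (fun Y : Finset (TPt d N) => Real.exp (-κ * torusTreeLen Y))
      (fun Y hY => (hF Y hY).2)).symm
  have hsub : Fam.subtype IsTDom ⊆ (tcubeSys d N).above x := by
    intro X hX
    exact (mem_above (G := tcubeSys d N) (c := x)).mpr ((hF X.1 (Finset.mem_subtype.mp hX)).1)
  have h4 : ∑ X ∈ Fam.subtype IsTDom, Real.exp (-κ * torusTreeLen X.1)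
      ≤ ∑ X ∈ (tcubeSys d N).above x, Real.exp (-κ * (tsys d N).dj X) := by
    refine (Finset.sum_le_sum_of_subset_of_nonneg hsub fun X _ _ => (Real.exp_pos _).le).trans (le_of_eq ?_)
    exact Finset.sum_congr rfl fun X _ => by rw [tsys_dj]
  have h5 := ineq126_torus d N hκ x
  calc ∑ i ∈ sl, w i ≤ ∑ i ∈ sl, E₀ * Real.exp (-κ * torusTreeLen (cells j i)) := h1
    _ = E₀ * ∑ Y ∈ Fam, Real.exp (-κ * torusTreeLen Y) := by rw [← mul_sum, h2]
    _ ≤ E₀ * K₀ (4 * 2 ^ d) (2 * d) := by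
        refine mul_le_mul_of_nonneg_left ?_ hE
        rw [h3]
        exact h4.trans h5

end TorusK

/-! ## §4 File 38's multiplicity on the cell's tori for BOND cells (the ledger cells of NODE S's bond supports) -/

open Classical in
/-- **MULTIPLICITY FROM CONNECTEDNESS + DECAY, BOND CELLS ON THE TORI** — file 38's `multiplicity_of_connected_decay` with `S j = PBond P j`
(any bounded-degree adjacency on bonds), `vol = |bonds of T^{(K)}|`, `Λ = L^d`: the count is file 36's `card_pbond_eq_unit_mul_real` (the bond
twin of file 38's `multiplicity_of_connected_decay_sites`). [folklore] -/
theorem multiplicity_of_connected_decay_bonds {ι : Type*} {P : Params} (fac : Finset ι) (sc : ι → ℕ)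
    (cells : (j : ℕ) → ι → Finset (PBond P j)) (w : ι → ℝ) (R : (j : ℕ) → PBond P j → PBond P j → Prop)
    (nbr : (j : ℕ) → PBond P j → Finset (PBond P j)) {Δ : ℕ} (hR : ∀ j x y, R j x y → R j y x)
    (hΔ : ∀ j x, (nbr j x).card ≤ Δ) (hnbr : ∀ j x y, R j x y → y ∈ nbr j x) {C lam : ℝ} (hC : 0 ≤ C) (hlam : 0 ≤ lam)
    (hsmall : ((Δ : ℝ) + 1) ^ 2 * lam ≤ 1 / 2) (hconn : ∀ i ∈ fac, IsRConnected (R (sc i)) (cells (sc i) i))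
    (hinj : ∀ j, Set.InjOn (cells j) ↑(fac.filter fun i => sc i = j)) (hw0 : ∀ i ∈ fac, 0 ≤ w i)
    (hw : ∀ i ∈ fac, w i ≤ C * lam ^ (cells (sc i) i).card) :
    Multiplicity fac sc w (C * (2 * lam)) (Fintype.card (PBond P P.K)) ((P.L : ℝ) ^ P.d) P.K :=
  multiplicity_of_connected_decay fac sc cells w R nbr hR hΔ hnbr hC hlam hsmall hconn hinj hw0 hw
    fun _ hj => (card_pbond_eq_unit_mul_real P hj).le

end Summit.QuantumFields.BalabanUV.T4Continuum.Spine.NE7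

end
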